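import Summits.QuantumFields.BalabanUV.T4Continuum.Support.RegionCollarLift
import Summits.QuantumFields.BalabanUV.T4Continuum.Support.RegionGaugeSliceTorus
import Summits.QuantumFields.BalabanUV.T4Continuum.Support.RegionStarLineGaugeTower

/-!
# `BalabanUV.T4Continuum.Support.RegionGaugeHoled` — NE2 (node U1a) formalisation swarm, SUPPLIER item «Δ1-VEC-W1-HOLED» under the
# owner's sub-row `T4-U1a.S-NE2-D1-DIRICHLET°` (vector layer W1), file 4/4: **THE DISPLAYED W1 INEQUALITY HOLDS, WITH ONE LEVEL-UNIFORM
# CONSTANT, ON THE COMPLEMENT OF A BLOCK** `S = (· ≠ w)` — the first RE-ENTRANT region class — by TORUS GAUGE TRANSFER WITH A FOLDED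
# COLLAR CORRECTION «not in print; our construction» (unit b2b-balaban-t4-ne2-formalise-leaf-09, gen 9, v1)

HONEST FRAMING (T4-DAG p. 1).  [folklore] `U = 1`, the faithful single-scale star-bond region operator `Δ_a(Ω₀)` of leaf-07's
`RegionGaugeFixedVector`, ONE region `Ω₀ = Ω(S)`, `S = T ∖ {w}` (`3 ≤ M_ν` for every `ν`), finite torus.  THE ARGUMENT: (1) a star-bond
field `A` on `S` is a field on ALL bonds (zero inside `w`); leaf-07-g6's `sliceCoercive_top` and gen 9's orbit form give a TORUS gauge `μ̃`
with ALL BLOCK MEANS ZERO and `γ_D·nsq (ext A − ∂μ̃) ≤ nsq (curlR A) + a·n^d·nsq (avgR A)` (the right-hand side of W1 on `S`: `curlR`, `avgR`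
ARE the torus curl ∕ Bałaban average of the zero-extension); (2) inside `w`, `ext A = 0`, so the in-block gradient of `μ̃` on `w` and — by
leaf-01-g4's block Poincaré with mean zero — the mass of `μ̃` on `w` are `≤ nsq (ext A − ∂μ̃)`; (3) the collar lift `λ = χ·(μ̃ ∘ F)`
(files 1–3) equals `μ̃` on `w` and has `nsq (∂λ) ≤ 2(d+1)3^d·nsq (ext A − ∂μ̃)`; (4) `μ := μ̃ − λ` on `Ω(S)` is a DIRICHLET gauge with
`A − ∂_Ω μ = (ext A − ∂μ̃) + ∂λ` on the star bonds.  Hence the gauge–Poincaré inequality on `S` with constants `C(d)/γ_D`, the orbit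
form (p230089) and gen 8's junction: **`sliceCoercive_holed`** with the constant `holedConst d a a′`, free of `n`, `M`, `w`.  WHY THE COLLAR
(gen 9 memo §3): truncating `μ̃` to `Ω` directly costs the boundary trace — a factor `n`; the fold spreads the transition over a block.
Nothing printed is a hypothesis; NE2 (U1a) NOT proved; spine PROVED 0/9 unchanged; NOT [B9] (3.16)∕(3.23)–(3.27) as printed; general
contact-free unions remain OPEN (several holes: `RegionGaugeScattered`∕`RegionGaugeSparse`; box components: `RegionGaugeBoxHole`); NOT
infinite volume, NOT the mass gap, NOT Clay.  HONEST DEPENDENCY (verbatim): «continuum YM on T⁴ ⇐ BetaPertH ∧ nine spine estimates (0/9 proved); BetaPertH ⇐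
(D1) ∧ (D4) ∧ CAP+tail; G-an2-4 gates asym, D1 and NE2/3/4.»

ABSOLUTE RULE (cell, verbatim): «No internally-minted statement may enter as a cited fact. Every hypothesis is either kernel-proved in
this package or a verbatim quotation of a PUBLISHED theorem with page reference. The manuscript(s) under audit are NOT citable for
their own disputed steps — they are the thing under adjudication; programme-internal (2001/route/tribunal) claims are never citable.»
[folklore] throughout; one real constant `holedConst`; no `def … : Prop`.  NOT CLAIMED: several holes; general unions; W3̃; NE2; NE3.
-/

noncomputable section

open scoped BigOperators ComplexConjugate Matrix Matrix.Norms.L2Operator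
open Finset

namespace Summit.QuantumFields.BalabanUV.T4Continuum.RegionGaugeHoled

open Literature.MathematicalPhysics.QuantumFieldTheory.Balaban1983to89.B5Prop11Plancherel (Tor fine unitVec)
open Literature.MathematicalPhysics.QuantumFieldTheory.Balaban1983to89.B5Prop11Lower (nsq nsq_nonneg)
open Literature.MathematicalPhysics.QuantumFieldTheory.Balaban1983to89.B5Action121 (GradOp GradOp_mulVec sdiff sdiff_mulVec CurlOp)
open Literature.MathematicalPhysics.QuantumFieldTheory.Balaban1983to89.B5Block118 (bpt QsOp)
open Literature.MathematicalPhysics.QuantumFieldTheory.Balaban1983to89.B5Blocks16 (blockOf blockOf_bpt bpt_injective)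
open Literature.MathematicalPhysics.QuantumFieldTheory.Balaban1983to89.B5G183RateUnitTower (lev)
open Summit.QuantumFields.BalabanUV.T4Continuum
open Summit.QuantumFields.BalabanUV.T4Continuum.SubtypeCompression (Coercive ext ext_apply_of ext_apply_of_not nsq_ext)
open Summit.QuantumFields.BalabanUV.T4Continuum.ScalarAveragedPropagator (gammaPs)
open Summit.QuantumFields.BalabanUV.T4Continuum.ScalarAveragedCompression (sigma0 sigma0_pos)
open Summit.QuantumFields.BalabanUV.T4Continuum.ScalarBlockTrialFunction (digits digits_bpt bpt_add_unitVec_of_lt)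
open Summit.QuantumFields.BalabanUV.T4Continuum.ScalarBlockPoincareLocal (sum_block_norm_sub_mean_sq_le)
open Summit.QuantumFields.BalabanUV.T4Continuum.RegionScalarCompression (QOm GOm)
open Summit.QuantumFields.BalabanUV.T4Continuum.RegionGaugeFixedVector (starReg curlR gradR avgR regionDeltaA)
open Summit.QuantumFields.BalabanUV.T4Continuum.RegionGaugeFixedVectorFlat (submatrix_mulVec_eq avgR_mulVec)
open Summit.QuantumFields.BalabanUV.T4Continuum.RegionGaugeSlice (SliceCoercive)
open Summit.QuantumFields.BalabanUV.T4Continuum.RegionGaugeSliceOrth (OrthSliceCoercive)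
open Summit.QuantumFields.BalabanUV.T4Continuum.RegionGaugeSliceOrthRegion (sliceCoercive_region_of_orthSlice orthSlice_region_of_sliceCoercive
  coercive_regionDeltaA_of_orthSlice opNorm_inv_regionDeltaA_le_of_orthSlice)
open Summit.QuantumFields.BalabanUV.T4Continuum.RegionGaugeSliceTorus (sliceCoercive_top nsq_curlR_mulVec starReg_topU)
open Summit.QuantumFields.BalabanUV.T4Continuum.RegionGaugeOrbit (orbitConst orbitConst_pos orthSlice_of_gaugePoincare gaugePoincare_of_orthSlice)
open Summit.QuantumFields.BalabanUV.T4Continuum.RegionStarLineGaugeTower (orthSlice_one orbitConst_le)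
open Summit.QuantumFields.BalabanUV.T4Continuum.DirichletRegionTower (gamD gamD_pos)
open Summit.QuantumFields.BalabanUV.T4Continuum.RegionCollarFold
open Summit.QuantumFields.BalabanUV.T4Continuum.RegionCollarCutoff
open Summit.QuantumFields.BalabanUV.T4Continuum.RegionCollarLift
open Summit.QuantumFields.BalabanUV.Beta.GAN24.DirichletBoxCompression (toBlock_mulVec')
open Summit.QuantumFields.BalabanUV.Beta.GAN24.DirichletBoxTrace (blockReg)

variable {d : ℕ} (n : ℕ) [NeZero n] (M : Fin d → ℕ) [hM : ∀ μ, NeZero (M μ)] (w : Tor M) (a a' : ℝ)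


/-! ## §1 The torus gauge with zero block means (any region `S`) -/

section Torus

variable (S : Tor M → Prop) [DecidablePred S]

/-- a star-bond field of `S` read on the star bonds of the whole torus (all bonds). [folklore] -/
def toTop (A : {b // starReg n M S b} → ℂ) : {b // starReg n M (fun _ : Tor M => True) b} → ℂ := fun b => ext (starReg n M S) A b.1

/-- the two zero-extensions agree. [folklore] -/
theorem ext_toTop (A : {b // starReg n M S b} → ℂ) : ext (starReg n M (fun _ : Tor M => True)) (toTop n M S A) = ext (starReg n M S) A := by
  funext b
  exact ext_apply_of (starReg n M (fun _ : Tor M => True)) (toTop n M S A) ⟨b, starReg_topU n M b⟩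

/-- same curl energy. [folklore] -/
theorem nsq_curlR_toTop (A : {b // starReg n M S b} → ℂ) : nsq (curlR n M (fun _ : Tor M => True) *ᵥ toTop n M S A) = nsq (curlR n M S *ᵥ A) := by
  rw [nsq_curlR_mulVec, nsq_curlR_mulVec, ext_toTop]

/-- same block averages. [folklore] -/
theorem avgR_toTop (A : {b // starReg n M S b} → ℂ) : avgR n M (fun _ : Tor M => True) *ᵥ toTop n M S A = avgR n M S *ᵥ A := by
  rw [avgR_mulVec, avgR_mulVec, ext_toTop]

/-- **THE TORUS GAUGE WITH ZERO BLOCK MEANS** (`1 ≤ n`, `0 < a`, `0 < a′`; ANY region `S`): for every star field `A` of `S` there is a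
scalar `μ̃` on the fine torus with `Q′μ̃ = 0` and `γ_D·nsq (ext A − ∂μ̃) ≤ nsq (curlR A) + a n^d nsq (avgR A)` — leaf-07-g6's
`sliceCoercive_top` through the orbit form (p230089). [folklore] -/
theorem exists_torus_gauge (hn : 1 ≤ n) (ha : 0 < a) (ha' : 0 < a') (A : {b // starReg n M S b} → ℂ) :
    ∃ μt : Tor (fine n M) → ℂ, (∀ y, (QsOp n M *ᵥ μt) y = 0) ∧
      gamD d a * nsq (fun b => ext (starReg n M S) A b - (GradOp (fine n M) (n : ℂ) *ᵥ μt) b)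
        ≤ nsq (curlR n M S *ᵥ A) + a * (n : ℝ) ^ d * nsq (avgR n M S *ᵥ A) := by
  classical
  have hO := orthSlice_region_of_sliceCoercive n M a a' (fun _ : Tor M => True) ha' (gamD_pos (d := d) a).le (sliceCoercive_top n M a a' hn ha ha')
  obtain ⟨μ, hQ, hμ⟩ := gaugePoincare_of_orthSlice n M a a' (fun _ : Tor M => True) ha' hO (toTop n M S A)
  refine ⟨ext (blockReg n M (fun _ : Tor M => True)) μ, fun y => ?_, ?_⟩
  · have h := congrFun hQ ⟨y, trivial⟩
    rw [QOm, toBlock_mulVec'] at h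
    exact h
  · have hres : ext (starReg n M (fun _ : Tor M => True)) (toTop n M S A - gradR n M (fun _ : Tor M => True) *ᵥ μ)
        = fun b => ext (starReg n M S) A b - (GradOp (fine n M) (n : ℂ) *ᵥ ext (blockReg n M (fun _ : Tor M => True)) μ) b := by
      funext b
      rw [ext_apply_of (starReg n M (fun _ : Tor M => True)) _ ⟨b, starReg_topU n M b⟩, Pi.sub_apply, gradR, toBlock_mulVec']
      simp only
      rw [← ext_toTop n M S A, ext_apply_of (starReg n M (fun _ : Tor M => True)) _ ⟨b, starReg_topU n M b⟩]
    rw [← hres, nsq_ext, ← nsq_curlR_toTop n M S A, ← avgR_toTop n M S A]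
    exact hμ

/-- **THE IN-BLOCK GRADIENT OF `μ̃` ON AN EXTERIOR BLOCK IS RESIDUAL ENERGY, summed over any finite set `E` of exterior blocks**:
`Σ_{w ∈ E} Σ_ρ gradSum_ρ^w μ̃ ≤ nsq (ext A − ∂μ̃)` (inside an exterior block `ext A = 0`; distinct blocks have distinct bonds). [folklore] -/
theorem sum_gradSum_le_residual (E : Finset (Tor M)) (hE : ∀ w ∈ E, ¬ S w) (A : {b // starReg n M S b} → ℂ)
    (μt : Tor (fine n M) → ℂ) :
    ∑ w ∈ E, ∑ ρ, gradSum n M w μt ρ ≤ nsq (fun b => ext (starReg n M S) A b - (GradOp (fine n M) (n : ℂ) *ᵥ μt) b) := by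
  classical
  set R : Tor (fine n M) × Fin d → ℂ := fun b => ext (starReg n M S) A b - (GradOp (fine n M) (n : ℂ) *ᵥ μt) b with hR
  -- a bond inside an exterior block is not a star bond, so it carries `‖R‖² = ‖∂μ̃‖²`
  have hns : ∀ w ∈ E, ∀ (j : Fin d → Fin n) (ρ : Fin d), (j ρ : ℕ) + 1 < n → ¬ starReg n M S (bpt n M w j, ρ) := by
    intro w hw j ρ h
    rintro (h1 | h2)
    · have h1' : S (blockOf n M (bpt n M w j)) := h1
      rw [blockOf_bpt] at h1'
      exact hE w hw h1'
    · have h2' : S (blockOf n M (bpt n M w j + unitVec (fine n M) ρ)) := h2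
      rw [bpt_add_unitVec_of_lt n M w j ρ h, blockOf_bpt] at h2'
      exact hE w hw h2'
  have hterm : ∀ w ∈ E, ∀ ρ, ∀ j ∈ Tin n ρ,
      ‖(sdiff (fine n M) (n : ℂ) ρ *ᵥ μt) (bpt n M w j)‖ ^ 2 = ‖R (bpt n M w j, ρ)‖ ^ 2 := by
    intro w hw ρ j hj
    have hlt := (mem_filter.1 hj).2
    rw [hR]
    simp only
    rw [ext_apply_of_not _ _ (hns w hw j ρ hlt), zero_sub, norm_neg, GradOp_mulVec]
  have hnsq : nsq R = ∑ ρ : Fin d, ∑ x : Tor (fine n M), ‖R (x, ρ)‖ ^ 2 := by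
    unfold nsq; rw [Fintype.sum_prod_type, sum_comm]
  rw [hnsq, sum_comm]
  refine sum_le_sum fun ρ _ => ?_
  calc ∑ w ∈ E, gradSum n M w μt ρ = ∑ w ∈ E, ∑ j ∈ Tin n ρ, ‖R (bpt n M w j, ρ)‖ ^ 2 :=
        sum_congr rfl fun w hw => by rw [gradSum, sum_congr rfl (hterm w hw ρ)]
    _ ≤ ∑ w ∈ E, ∑ j, ‖R (bpt n M w j, ρ)‖ ^ 2 :=
        sum_le_sum fun w _ => sum_le_sum_of_subset_of_nonneg (subset_univ _) fun _ _ _ => by positivity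
    _ = ∑ wj ∈ E ×ˢ (univ : Finset (Fin d → Fin n)), ‖R (bpt n M wj.1 wj.2, ρ)‖ ^ 2 := by
        rw [Finset.sum_product' (f := fun w' j => ‖R (bpt n M w' j, ρ)‖ ^ 2)]
    _ = ∑ x ∈ (E ×ˢ (univ : Finset (Fin d → Fin n))).image (fun wj => bpt n M wj.1 wj.2), ‖R (x, ρ)‖ ^ 2 := by
        rw [Finset.sum_image]
        intro a _ b _ h
        exact bpt_injective n M h
    _ ≤ ∑ x, ‖R (x, ρ)‖ ^ 2 := sum_le_sum_of_subset_of_nonneg (subset_univ _) fun _ _ _ => by positivity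

end Torus

/-! ## §2 The mass of the torus gauge on a block -/

/-- **THE MASS OF `μ̃` ON `w` IS RESIDUAL ENERGY** (block Poincaré with zero block mean): `Σ_j ‖μ̃ (bpt w j)‖² ≤ Σ_ρ gradSum_ρ μ̃`. [folklore] -/
theorem mass_le_gradSum (μt : Tor (fine n M) → ℂ) (hQ : (QsOp n M *ᵥ μt) w = 0) :
    ∑ j : Fin d → Fin n, ‖μt (bpt n M w j)‖ ^ 2 ≤ ∑ ρ, gradSum n M w μt ρ := by
  have h := sum_block_norm_sub_mean_sq_le n M μt w
  simp only [hQ, sub_zero] at h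
  refine h.trans ?_
  have hc : ((n : ℝ) - 1) / (2 * n) ≤ 1 := by
    have hn : (1 : ℝ) ≤ n := by exact_mod_cast Nat.pos_of_ne_zero (NeZero.ne n)
    rw [div_le_one (by positivity)]; linarith
  have hW : 0 ≤ ∑ ρ, gradSum n M w μt ρ := sum_nonneg fun ρ _ => sum_nonneg fun _ _ => by positivity
  calc ((n : ℝ) - 1) / (2 * n) * ∑ ρ, gradSum n M w μt ρ ≤ 1 * ∑ ρ, gradSum n M w μt ρ := mul_le_mul_of_nonneg_right hc hW
    _ = _ := one_mul _

/-! ## §3 The Dirichlet correction and the gauge–Poincaré inequality on `T ∖ {w}` -/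

/-- the universal constant of the transfer: `K(d) = 2 + 4(d+1)·3^d`. [folklore] -/
def Kholed (d : ℕ) : ℝ := 2 + 4 * ((d : ℝ) + 1) * 3 ^ d

/-- **THE GAUGE–POINCARÉ INEQUALITY ON THE COMPLEMENT OF A BLOCK** (`3 ≤ M_ν`, `1 ≤ n`, `0 < a`, `0 < a′`): every star field `A` has a
DIRICHLET gauge `μ` on `Ω(S)` with `nsq (A − ∂_Ω μ) ≤ (K/γ_D)·nsq (curlR A) + (K a/γ_D)·(n^d·nsq (avgR A))`. [folklore] -/
theorem gaugePoincare_holed (hM3 : ∀ μ, 3 ≤ M μ) (hn : 1 ≤ n) (ha : 0 < a) (ha' : 0 < a') (A : {b // starReg n M (fun y : Tor M => y ≠ w) b} → ℂ) :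
    ∃ μ : {x // blockReg n M (fun y : Tor M => y ≠ w) x} → ℂ,
      nsq (A - gradR n M (fun y : Tor M => y ≠ w) *ᵥ μ) ≤ Kholed d / gamD d a * nsq (curlR n M (fun y : Tor M => y ≠ w) *ᵥ A)
        + Kholed d * a / gamD d a * ((n : ℝ) ^ d * nsq (avgR n M (fun y : Tor M => y ≠ w) *ᵥ A)) := by
  classical
  have hM2 : ∀ μ, 2 ≤ M μ := fun μ => le_of_lt (hM3 μ)
  obtain ⟨μt, hQ, hμt⟩ := exists_torus_gauge n M a a' (fun y : Tor M => y ≠ w) hn ha ha' A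
  set R : Tor (fine n M) × Fin d → ℂ := fun b => ext (starReg n M (fun y : Tor M => y ≠ w)) A b - (GradOp (fine n M) (n : ℂ) *ᵥ μt) b with hR
  set lam := lift n M w μt with hlam
  -- the corrected gauge on `Ω(S)`
  refine ⟨fun x => μt x.1 - lam x.1, ?_⟩
  -- its zero-extension is `μ̃ − λ` everywhere (they agree to vanish on `w`)
  have hext : ext (blockReg n M (fun y : Tor M => y ≠ w)) (fun x : {x // blockReg n M (fun y : Tor M => y ≠ w) x} => μt x.1 - lam x.1) = μt - lam := by
    funext x
    by_cases hx : blockReg n M (fun y : Tor M => y ≠ w) x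
    · exact ext_apply_of (blockReg n M (fun y : Tor M => y ≠ w)) _ ⟨x, hx⟩
    · rw [ext_apply_of_not _ _ hx, Pi.sub_apply]
      have hw : blockOf n M x = w := by
        by_contra h
        exact hx h
      rw [hlam, lift_of_blockOf_eq n M w hM2 μt hw, sub_self]
  -- the residual on the star bonds is `R + ∂λ`
  have hres : ext (starReg n M (fun y : Tor M => y ≠ w)) (A - gradR n M (fun y : Tor M => y ≠ w) *ᵥ fun x => μt x.1 - lam x.1)
      = fun b => if starReg n M (fun y : Tor M => y ≠ w) b then R b + (GradOp (fine n M) (n : ℂ) *ᵥ lam) b else 0 := by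
    funext b
    by_cases hb : starReg n M (fun y : Tor M => y ≠ w) b
    · rw [if_pos hb, ext_apply_of (starReg n M (fun y : Tor M => y ≠ w)) _ ⟨b, hb⟩, Pi.sub_apply, gradR, toBlock_mulVec', hext, hR]
      simp only
      rw [Matrix.mulVec_sub, Pi.sub_apply, ext_apply_of (starReg n M (fun y : Tor M => y ≠ w)) A ⟨b, hb⟩]
      ring
    · rw [if_neg hb, ext_apply_of_not _ _ hb]
  -- energies
  have hgrad : nsq (GradOp (fine n M) (n : ℂ) *ᵥ lam) ≤ (2 * 3 ^ d + 2 * d * 3 ^ d) * nsq R := by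
    have h1 := nsq_grad_lift_le n M w hM3 μt
    have h2 : ∑ ρ, gradSum n M w μt ρ ≤ nsq R := by
      have h := sum_gradSum_le_residual n M (fun y : Tor M => y ≠ w) {w} (fun w' hw' => by simpa using hw') A μt
      simpa using h
    have h3 := mass_le_gradSum n M w μt (hQ w)
    have h33 : (0 : ℝ) ≤ 2 * d * 3 ^ d := by positivity
    have h22 : (0 : ℝ) ≤ 2 * 3 ^ d := by positivity
    calc nsq (GradOp (fine n M) (n : ℂ) *ᵥ lam)
        ≤ 2 * 3 ^ d * ∑ ρ, gradSum n M w μt ρ + 2 * d * 3 ^ d * ∑ j : Fin d → Fin n, ‖μt (bpt n M w j)‖ ^ 2 := h1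
      _ ≤ 2 * 3 ^ d * nsq R + 2 * d * 3 ^ d * nsq R :=
          add_le_add (mul_le_mul_of_nonneg_left h2 h22) (mul_le_mul_of_nonneg_left (h3.trans h2) h33)
      _ = _ := by ring
  have hsum : nsq (A - gradR n M (fun y : Tor M => y ≠ w) *ᵥ fun x => μt x.1 - lam x.1) ≤ 2 * nsq R + 2 * nsq (GradOp (fine n M) (n : ℂ) *ᵥ lam) := by
    rw [← nsq_ext (starReg n M (fun y : Tor M => y ≠ w)), hres]
    unfold nsq
    rw [mul_sum, mul_sum, ← sum_add_distrib]
    refine sum_le_sum fun b _ => ?_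
    dsimp only
    split_ifs
    · -- `‖u + v‖² ≤ 2‖u‖² + 2‖v‖²`
      have := norm_add_le (R b) ((GradOp (fine n M) (n : ℂ) *ᵥ lam) b)
      nlinarith [norm_nonneg (R b + (GradOp (fine n M) (n : ℂ) *ᵥ lam) b), norm_nonneg (R b),
        norm_nonneg ((GradOp (fine n M) (n : ℂ) *ᵥ lam) b), sq_nonneg (‖R b‖ - ‖(GradOp (fine n M) (n : ℂ) *ᵥ lam) b‖)]
    · rw [norm_zero]
      nlinarith [norm_nonneg (R b), norm_nonneg ((GradOp (fine n M) (n : ℂ) *ᵥ lam) b)]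
  -- assemble
  have hγ := gamD_pos (d := d) a
  have hRle : nsq R ≤ (nsq (curlR n M (fun y : Tor M => y ≠ w) *ᵥ A) + a * (n : ℝ) ^ d * nsq (avgR n M (fun y : Tor M => y ≠ w) *ᵥ A)) / gamD d a := by
    rw [le_div_iff₀ hγ, mul_comm]; exact hμt
  have hK : nsq (A - gradR n M (fun y : Tor M => y ≠ w) *ᵥ fun x => μt x.1 - lam x.1) ≤ Kholed d * nsq R := by
    calc nsq (A - gradR n M (fun y : Tor M => y ≠ w) *ᵥ fun x => μt x.1 - lam x.1)
        ≤ 2 * nsq R + 2 * ((2 * 3 ^ d + 2 * d * 3 ^ d) * nsq R) := by linarith [hsum, hgrad]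
      _ = Kholed d * nsq R := by rw [Kholed]; ring
  have hKpos : 0 ≤ Kholed d := by unfold Kholed; positivity
  calc nsq (A - gradR n M (fun y : Tor M => y ≠ w) *ᵥ fun x => μt x.1 - lam x.1) ≤ Kholed d * nsq R := hK
    _ ≤ Kholed d * ((nsq (curlR n M (fun y : Tor M => y ≠ w) *ᵥ A) + a * (n : ℝ) ^ d * nsq (avgR n M (fun y : Tor M => y ≠ w) *ᵥ A)) / gamD d a) :=
        mul_le_mul_of_nonneg_left hRle hKpos
    _ = _ := by simp only [div_eq_mul_inv]; ring

/-! ## §4 ENDs: W1 on the complement of a block -/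

/-- **THE W1 CONSTANT OF THE COMPLEMENT OF A BLOCK**: `holedConst d a a′ = orbitConst d a (K/γ_D) (K a/γ_D) / (1 + 4d/σ₀(d,a′))` — free of
`n`, `M`, `w`. [folklore] -/
def holedConst (d : ℕ) (a a' : ℝ) : ℝ :=
  orbitConst d a (Kholed d / gamD d a) (Kholed d * a / gamD d a) / (1 + 4 * d / sigma0 d a')

omit hM in
/-- `0 ≤ K a/γ_D`. [folklore] -/
theorem KC₂_nonneg (ha : 0 < a) : 0 ≤ Kholed d * a / gamD d a := by
  have := gamD_pos (d := d) a
  have : 0 ≤ Kholed d := by unfold Kholed; positivity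
  positivity

omit hM in
/-- `0 < holedConst d a a′` (`0 < a`, `0 < a′`). [folklore] -/
theorem holedConst_pos (ha : 0 < a) (ha' : 0 < a') : 0 < holedConst d a a' := by
  unfold holedConst
  have := sigma0_pos (d := d) ha'
  have := orbitConst_pos d (C₁ := Kholed d / gamD d a) (C₂ := Kholed d * a / gamD d a) ha (KC₂_nonneg a ha)
  positivity

/-- **W1 IN ORBIT FORM ON THE COMPLEMENT OF A BLOCK, EVERY LEVEL `n ≥ 1`** (`3 ≤ M_ν`, `0 < a`). [folklore] -/
theorem orthSlice_holed (hM3 : ∀ μ, 3 ≤ M μ) (ha : 0 < a) (ha' : 0 < a') :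
    OrthSliceCoercive (curlR n M (fun y : Tor M => y ≠ w)) (gradR n M (fun y : Tor M => y ≠ w)) (QOm n M (fun y : Tor M => y ≠ w)) (avgR n M (fun y : Tor M => y ≠ w)) (a * (n : ℝ) ^ d)
      (orbitConst d a (Kholed d / gamD d a) (Kholed d * a / gamD d a)) := by
  by_cases hn : 2 ≤ n
  · exact orthSlice_of_gaugePoincare n M a (fun y : Tor M => y ≠ w) hn ha (KC₂_nonneg a ha)
      (gaugePoincare_holed n M w a a' hM3 (by omega) ha ha')
  · obtain rfl : n = 1 := by have := NeZero.ne n; omega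
    exact orthSlice_one M (fun y : Tor M => y ≠ w) a (orbitConst_le ha (KC₂_nonneg a ha))

/-- **THE DISPLAYED W1 INEQUALITY ON THE COMPLEMENT OF A BLOCK — A THEOREM WITH ONE LEVEL-UNIFORM CONSTANT**: for `S = T ∖ {w}`,
`3 ≤ M_ν`, every level `n ≥ 1`, `0 < a`, `0 < a′`:
`SliceCoercive (curlR n M S) (gradR n M S) (GOm n M a′ S) (QOm n M S) (avgR n M S) (a·n^d) (holedConst d a a′)`. [folklore] -/
theorem sliceCoercive_holed (hM3 : ∀ μ, 3 ≤ M μ) (ha : 0 < a) (ha' : 0 < a') :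
    SliceCoercive (curlR n M (fun y : Tor M => y ≠ w)) (gradR n M (fun y : Tor M => y ≠ w)) (GOm n M a' (fun y : Tor M => y ≠ w)) (QOm n M (fun y : Tor M => y ≠ w)) (avgR n M (fun y : Tor M => y ≠ w)) (a * (n : ℝ) ^ d) (holedConst d a a') :=
  sliceCoercive_region_of_orthSlice n M a a' (fun y : Tor M => y ≠ w) ha' (orbitConst_pos d ha (KC₂_nonneg a ha)).le (orthSlice_holed n M w a a' hM3 ha ha')

/-- **HENCE `Δ_a(Ω₀)` IS COERCIVE ON THE COMPLEMENT OF A BLOCK**, uniformly in the level. [folklore] -/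
theorem coercive_regionDeltaA_holed (hM3 : ∀ μ, 3 ≤ M μ) (ha : 0 < a) (ha' : 0 < a') :
    Coercive (regionDeltaA n M a a' (fun y : Tor M => y ≠ w))
      (min (orbitConst d a (Kholed d / gamD d a) (Kholed d * a / gamD d a) / (1 + 4 * d / sigma0 d a') / 2)
        (1 / (2 * (gammaPs d a')⁻¹))) :=
  coercive_regionDeltaA_of_orthSlice n M a a' (fun y : Tor M => y ≠ w) ha' (orbitConst_pos d ha (KC₂_nonneg a ha)) (orthSlice_holed n M w a a' hM3 ha ha')

/-- **… AND «`G(Ω₀) = Δ_a(Ω₀)⁻¹` EXISTS WITH A LEVEL-UNIFORM BOUND» on the complement of a block**. [folklore] -/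
theorem opNorm_inv_regionDeltaA_holed_le (hM3 : ∀ μ, 3 ≤ M μ) (ha : 0 < a) (ha' : 0 < a') :
    ‖(regionDeltaA n M a a' (fun y : Tor M => y ≠ w))⁻¹‖
      ≤ (min (orbitConst d a (Kholed d / gamD d a) (Kholed d * a / gamD d a) / (1 + 4 * d / sigma0 d a') / 2)
          (1 / (2 * (gammaPs d a')⁻¹)))⁻¹ :=
  opNorm_inv_regionDeltaA_le_of_orthSlice n M a a' (fun y : Tor M => y ≠ w) ha' (orbitConst_pos d ha (KC₂_nonneg a ha)) (orthSlice_holed n M w a a' hM3 ha ha')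

/-- **THE STAR-TOWER W1 SOCKET `hS : ∀ k, SliceCoercive (… lev L k …) c` IS DISCHARGED ON THE COMPLEMENT OF A BLOCK** (the shape of
`DirichletStarVectorTower.towerLimitRate_star_of(_linear)` ∕ `DirichletStarClassPoincare.towerLimitRate_star_renorm_of_interior`; the
other binders of those ENDs stay displayed). [folklore] -/
theorem sliceCoercive_lev_holed (L : ℕ) [NeZero L] (hM3 : ∀ μ, 3 ≤ M μ) (ha : 0 < a) (ha' : 0 < a') (k : ℕ) :
    SliceCoercive (curlR (lev L k) M (fun y : Tor M => y ≠ w)) (gradR (lev L k) M (fun y : Tor M => y ≠ w)) (GOm (lev L k) M a' (fun y : Tor M => y ≠ w)) (QOm (lev L k) M (fun y : Tor M => y ≠ w)) (avgR (lev L k) M (fun y : Tor M => y ≠ w))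
      (a * ((lev L k : ℕ) : ℝ) ^ d) (holedConst d a a') :=
  sliceCoercive_holed (lev L k) M w a a' hM3 ha ha'

end Summit.QuantumFields.BalabanUV.T4Continuum.RegionGaugeHoled

end
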